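import Mathlib
import Literature.Computability.Complexity.RangeAvoidance
import Literature.Computability.Complexity.SignDegreeXor
import HarnessLib.Audit
import Summits.PneNP.PneNP.Theorems.PstarTyped

/-!
# Level-`t` Sherali–Adams feasibility of a fibre, and the linear-level target for typed `P⋆` (cell `pnp-ideate`, ROUND-21 seed)

FRONTIER range-avoidance ladder, rung F-N3 context (restricted-model lower bounds for a relaxation hierarchy — nothing
here bears on `P` vs `NP`).

`SAFeasible t I y` is the level-`t` Sherali–Adams relaxation of the system `I(x) = y` for a `k`-local map `I`, in the
"locally consistent distributions" form (O'Donnell–Witmer 2014, Def. II.4; Benabbas–Georgiou–Magen–Tulsiani 2012, Lemma 2.3):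
a law `D S` for every set `S` of at most `t` variables (represented as a law on full assignments of which only the
`S`-marginal matters), probability-normalised, with consistent marginals (`D S` and `D T` agree on every `T`-cylinder for
`T ⊆ S`), and supported on assignments satisfying every output constraint `I(x)_j = y_j` whose variables lie inside `S`.
A level-`t` Sherali–Adams REFUTATION of "`y ∈ Range(I)`" exists iff `¬ SAFeasible t I y`.

Sanity (both ends of the hierarchy): a range point is feasible at every level (`saFeasible_of_mem_range`), level `n` is
exact (`mem_range_of_saFeasible`), and feasibility is antitone in the level (`SAFeasible.anti`).

TARGET `TypedSALinearLevel` (ROUND-21, T21.1 of the cell memo `r20/ROUND-20-SEED.md` §8; OPEN, tagged conjecture): on a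
TYPED pure-`P⋆` instance whose output hypergraph is boundary-expanding up to size `r` and has simple overlaps, the fibre of
EVERY target `y` is Sherali–Adams feasible at level `r / c` for an absolute constant `c`.  Rationale: BGMT's construction of
consistent local laws from a pairwise independent supporting distribution goes through with BALANCE replaced by
TYPE-CONSISTENT BIASES — the laws `PstarPairwise.lp (√2/2) (y j)` (biases `½` on XOR variables, `1/√2` on AND variables,
pairwise independent, marginals independent of `y j`) and the junction-tree reweighting
`P_y(S)(α) ∝ ∏_j lp(α|T_j) · ∏_v p_v(α_v)^{1 - deg(v)}`; the level-2 case without any expansion hypothesis is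
`PstarSA2Blind.sa2Feasible_of_typed`.  Consequence if proved: no "choose `y`, then refute the fibre by Sherali–Adams of
level `o(n)`" algorithm solves typed `P⋆` avoidance at any linear stretch (the M19 certificate is the level-2 member).
-/

set_option linter.dupNamespace false

open Literature.Computability.Complexity Finset

namespace Summit.PneNP.PneNP.Theorems.PstarSALevel

variable {k n m : ℕ}

/-- The mass a law `D` on assignments gives to the `T`-cylinder of `a` (assignments agreeing with `a` on `T`). -/
def cyl (D : (Fin n → Bool) → ℝ) (T : Finset (Fin n)) (a : Fin n → Bool) : ℝ :=
  ∑ x ∈ univ.filter (fun x => ∀ i ∈ T, x i = a i), D x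

/-- The set of variables read by output `j`. -/
def varSet (I : LocalMap k n m) (j : Fin m) : Finset (Fin n) := univ.image (I.vars j)

/-- **Level-`t` Sherali–Adams feasibility** of the system `I(x) = y`: locally consistent laws on all sets of at most `t`
variables, each supported on assignments satisfying the output constraints that live inside its set. -/
def SAFeasible (t : ℕ) (I : LocalMap k n m) (y : Fin m → Bool) : Prop :=
  ∃ D : Finset (Fin n) → (Fin n → Bool) → ℝ,
    (∀ S, S.card ≤ t → (∀ x, 0 ≤ D S x) ∧ ∑ x, D S x = 1) ∧
    (∀ S T, T ⊆ S → S.card ≤ t → ∀ a, cyl (D S) T a = cyl (D T) T a) ∧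
    (∀ S (j : Fin m), S.card ≤ t → varSet I j ⊆ S → ∀ x, D S x ≠ 0 → I.eval x j = y j)

/-- A range point is Sherali–Adams feasible at every level (Dirac family at a preimage). -/
theorem saFeasible_of_mem_range (t : ℕ) (I : LocalMap k n m) {y : Fin m → Bool} (h : y ∈ I.range) :
    SAFeasible t I y := by
  classical
  obtain ⟨x₀, hx₀⟩ := h
  refine ⟨fun _ x => if x = x₀ then 1 else 0, fun S _ => ⟨fun x => ?_, by simp⟩,
    fun S T _ _ a => rfl, fun S j _ _ x hx => ?_⟩
  · show (0 : ℝ) ≤ if x = x₀ then 1 else 0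
    split_ifs <;> norm_num
  · have hxx : x = x₀ := by
      by_contra hne
      exact hx (if_neg hne)
    subst hxx
    exact congrFun hx₀ j

/-- Level `n` (all variables) is exact: feasibility there means `y` is in the range. -/
theorem mem_range_of_saFeasible {t : ℕ} (I : LocalMap k n m) {y : Fin m → Bool} (h : SAFeasible t I y)
    (ht : n ≤ t) : y ∈ I.range := by
  classical
  obtain ⟨D, hprob, -, hsupp⟩ := h
  have hcard : (univ : Finset (Fin n)).card ≤ t := by simpa using ht
  have hne : ∑ x, D univ x ≠ 0 := by rw [(hprob univ hcard).2]; exact one_ne_zero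
  obtain ⟨x, -, hx⟩ := Finset.exists_ne_zero_of_sum_ne_zero hne
  exact ⟨x, funext fun j => hsupp univ j hcard (subset_univ _) x hx⟩

/-- Feasibility is antitone in the level. -/
theorem SAFeasible.anti {s t : ℕ} {I : LocalMap k n m} {y : Fin m → Bool} (h : SAFeasible t I y) (hst : s ≤ t) :
    SAFeasible s I y := by
  obtain ⟨D, hprob, hcons, hsupp⟩ := h
  exact ⟨D, fun S hS => hprob S (hS.trans hst), fun S T hTS hS => hcons S T hTS (hS.trans hst),
    fun S j hS => hsupp S j (hS.trans hst)⟩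

/-- Below level `n` a non-range point may still be feasible; at level `n` and above it is not. -/
theorem not_saFeasible_of_not_mem_range {t : ℕ} (I : LocalMap k n m) {y : Fin m → Bool} (hy : y ∉ I.range)
    (ht : n ≤ t) : ¬ SAFeasible t I y :=
  fun h => hy (mem_range_of_saFeasible I h ht)

/-- The boundary of a set `J` of outputs: variables read by EXACTLY ONE output of `J`. -/
def bdry (I : LocalMap k n m) (J : Finset (Fin m)) : Finset (Fin n) :=
  univ.filter fun v => (J.filter fun j => v ∈ varSet I j).card = 1

/-- `(r, 3/2)`-boundary expansion of the output hypergraph: every set of at most `r` outputs has at least `3/2 · |J|`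
boundary variables (BGMT's `(r, k - 3 + δ)` with `k = 4`, `δ = 1/2`). -/
def BoundaryExpanding (r : ℕ) (I : LocalMap k n m) : Prop :=
  ∀ J : Finset (Fin m), J.card ≤ r → 3 * J.card ≤ 2 * (bdry I J).card

/-- Simple overlaps: two distinct outputs share at most one variable. -/
def SimpleOverlap (I : LocalMap k n m) : Prop :=
  ∀ j j' : Fin m, j ≠ j' → (varSet I j ∩ varSet I j').card ≤ 1

/-- **T21.1 — the linear-level Sherali–Adams target for typed `P⋆` (OPEN; ROUND-21).**  There is an absolute constant `c`
such that on every typed pure-`P⋆` instance that is `(r, 3/2)`-boundary expanding with simple overlaps, the fibre of every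
target is Sherali–Adams feasible at level `r / c`. -/
@[conjecture] def TypedSALinearLevel : Prop :=
  ∃ c : ℕ, 0 < c ∧ ∀ (n m r : ℕ) (I : LocalMap 4 n m), I.IsPure xorAndPred → PstarTyped.Typed I →
    BoundaryExpanding r I → SimpleOverlap I → ∀ y : Fin m → Bool, SAFeasible (r / c) I y

end Summit.PneNP.PneNP.Theorems.PstarSALevel
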